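import Literature.MathematicalPhysics.QuantumFieldTheory.Balaban1983to89.B7SectEFLinearisationRec

/-!
# `Balaban1983to89.B7Prop3FlatRecSide` — [Balaban1985Averaging] (47)–(50) p. 25, (110)–(112) p. 34, (120)∕(124)–(125) p. 35–36 AT `V₀ = 1` FOR THE
# RECORD's AVERAGING STRUCTURE ([Balaban1987RG1] (0.3)–(0.4)): the first-order terms of the (0.4) average and of the single-staircase frames, the SIDE estimate, and the FRAME CANCELLATION WITH THE CURVATURE FUNCTIONAL `Φ` (LOCATED-N2): `−F̂(c₋) + T_c + F̂(c₊) = L·(Q₀A)_c + Φ(c₋) − Φ(c₊)`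

statement-level skeleton of published theorems with citation tags; proofs where landed; nothing here is a claim about the Yang–Mills mass gap

CITATION HEADER (lean-in-tree rule).  Cell `pub-ymgap`, seat `pub-ymgap-dag-n05-e` g35 (N05-REC LEAD PEN; director-ym №254∕№255∕№257, plan g90 SIZING WORD): item R1 ([3]
layer) ∕ N2 of the road — the FLAT half of Prop. 3 for the record structure, part 1 (side + frames + cancellation); part 2 (`B7Prop3FlatRec`: the double-bar
estimate (120)–(123) and the derivative (122)) follows.  `--kind proof --supports stmt-QuantumFields-20541` (K0⁷; count-neutral; definitions here are
first-order bookkeeping terms only: `XhatZ`, `TsideZ`, `SZ`, `PhiZ`).  Sources READ: [3] pp. 25, 34–36 (`paper:balaban1985-cmp98-averaging`, journal page = PDF page + 16)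
through the engine modules `B7Prop1Explicit` (`side_estimate`) and `B7Prop3Flat` (`frame_estimate`, `frame_cancellation`, `norm_linQ_le`), whose proofs are
re-run here token for token over the record objects; [I] (0.3)–(0.4) pp. 252–253 (`paper:balaban1987-cmp109-rg-i-small-field`).

WHY (LOCATED-N2 «MIXED LINEARISATION», director-ym RULING №257 = road (A′); desk `HOME/pub-ymgap-dag-n05-e/LOCATED-N2-MIXED-LINEARISATION.md`).  The typed
record pairs the SYMMETRIC loop family of (0.4) (`bavgZ`: all orderings `σ, σ′`) with SINGLE-staircase frames (`FhatZ ∕ FavgZ ∕ vframeZ`: `treeWord (offZ L r)`, the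
(1.7) staircase of `radialContourData`).  In the engine (and in print [I], which uses the averaged contours (0.11) throughout) the loop's first piece and the
frame share the staircase and cancel: `frame_cancellation : −F̂(c₋) + T_c + F̂(c₊) = L·(Q₀A)_c`.  Here the first piece of the loop is the σ-MEAN
`SZ(q)[A] = mean_{r,σ} A(Γ^σ_{q,x_r})` while the frame is `F̂Z(q)[A] = mean_r A(Γ^{tree}_{q,x_r})`, so the cancellation leaves the CURVATURE FUNCTIONAL
`Φ := SZ − F̂Z` (a signed plaquette sum of the curl, by lattice Stokes; ≠ 0 generically): **`−F̂Z(c₋) + TZ_c + F̂Z(c₊) = L·(Q₀A)_c + Φ(c₋) − Φ(c₊)`**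
(`frame_cancellationZ`) — the record's flat linearised averaging operator is `Q₀ − ∂∘Φ∘d`.  This file states the identity exactly and re-runs the engine's two
second-order estimates for the record objects; NO bound on Φ by the curl is made here (that is N2's estimate, next).

WHAT IS DEFINED (first-order bookkeeping terms) AND PROVED (sorry-free).
* §1 `XhatZ` (first-order term of the exponent `XZ`: `mean_i A(loop_i)`), `TsideZ := XhatZ + A([q, q + Le_κ])` (first-order term of `bavgZ`), `SZ` (the σ-mean staircase
  functional), `PhiZ := SZ − FhatZ` (the curvature functional Φ); the uniform-mean lemmas `norm_avgZ_le`, `sum_IdxZ_fst ∕ _perm₁ ∕ _perm₂`; words: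
  `wordRev_eq_revWord`, `replicate_false_eq_seg_neg`, `asum_loopWord` (the loop functional in four pieces), `l1_offZ_le_dL`.
* §2 ★ `frame_cancellationZ` (the identity above; formal sums, no smallness).
* §3 `side_estimateZ` — [3] (47)–(50) for `bavgZ`: in the region `V = e^{A}`, `|A_b| ≤ a`, `(2dL+2L)·a ≤ θ ≤ 1∕64`: `‖Ū(c) − 1‖ ≤ 3θ`, `‖Ū(c) − 1 − TZ_c‖ ≤ 50θ²`
  (and for `Ū(c)⁻¹`), every loop variable within `2θ` of `1`; `norm_linQZ_le`; the frame estimate (111)–(112), the double-bar estimate (120)–(123) and the derivative (122) are the sibling `B7Prop3FlatRec`.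
HONEST SCOPE.  First-order bookkeeping + two second-order estimates re-run from the engine; the located identity is about OUR typed objects; NO bound of Φ by the
curl yet; NO claim that the record's flat letters equal the engine's (they do not: LOCATED-N2); `HThm4Rec` UNDISCHARGED; N05 ∕ N07 NOT discharged; counts unmoved
(typed 28∕28 · discharged 7∕28); one finite 𝕋⁴ programme at fixed ε — nothing continuum ∕ ℝ⁴ ∕ OS ∕ mass gap ∕ Clay.  No `instance`, no `notation`, no `sorry`.
-/

set_option autoImplicit false

noncomputable section

open scoped BigOperators
open NormedSpace

namespace Literature.MathematicalPhysics.QuantumFieldTheory.Balaban1983to89.B7Prop3FlatRecSide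

open B7Prop1Explicit hiding Site
open B7Prop1Explicit renaming Site → SiteZ
open MatrixLog
open B7Prop3Flat (expCfg)
open BlockAveragingZd (offZ offZ_apply IdxZ WZ WZ_def XZ bavgZ length_loopWord disp_stairWord disp_loopWord)
open B7SectEFLinearisationRec (FhatZ FavgZ vframeZ dbavgZ linQZ)
open T4Continuum (stairWord loopWord wordRev axisRun)

variable {d : ℕ}

/-! ## §1 First-order terms, the uniform mean over `IdxZ`, the loop functional in four pieces -/

section Words

/-- `|n|₁ ≤ d·L` for the centred offsets (no parity needed; for odd `L` the sharp bound is `d·(L−1)∕2`, `BlockAveragingZd.l1_offZ_le`).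
[cite: Balaban1987RG1, (0.3) p.252] -/
theorem l1_offZ_le_dL (L : ℕ) (r : Fin d → Fin L) : l1 (offZ L r) ≤ d * L := by
  unfold l1
  calc ∑ ν, (offZ L r ν).natAbs ≤ ∑ _ν : Fin d, L := Finset.sum_le_sum fun ν _ => by
          have hr := (r ν).isLt
          rw [offZ_apply]
          omega
    _ = d * L := by simp

/-- NODE 00's `wordRev` is the engine's `revWord` (both reverse the word and flip every letter). [cite: Balaban1985Averaging, (9) p.18] -/
theorem wordRev_eq_revWord (w : List (Letter d)) : wordRev w = revWord w := by
  induction w with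
  | nil => rfl
  | cons l w ih =>
    rw [T4Continuum.wordRev_cons, revWord_cons, ih]
    rfl

/-- The backward run of `L` steps is the engine's segment `seg κ (−L)`. [cite: Balaban1985Averaging, p.20] -/
theorem replicate_false_eq_seg_neg (L : ℕ) (κ : Fin d) : List.replicate L (κ, false) = seg κ (-(L : ℤ)) := by
  cases L with
  | zero => rfl
  | succ n => rfl

/-- The forward run of `L` steps is the engine's segment `seg κ L`. [cite: Balaban1985Averaging, p.20] -/
theorem replicate_true_eq_seg (L : ℕ) (κ : Fin d) : List.replicate L (κ, true) = seg κ (L : ℤ) := rfl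

variable {𝔸 : Type*} [NormedRing 𝔸]

/-- **The loop functional of (0.4) in four pieces**: `A(Γ^σ_{q,x} ∪ [x,x′] ∪ (−Γ^{σ′}_{q′,x′}) ∪ (−c)) = A(Γ^σ_{q,x}) + A([x,x′]) − A(Γ^{σ′}_{q′,x′}) − A([q,q′])`,
`x = q + n`, `x′ = x + Le_κ`, `q′ = q + Le_κ`. [cite: Balaban1987RG1, (0.4) p.253; Balaban1985Averaging, (14) p.19] -/
theorem asum_loopWord (A : SiteZ d → Fin d → 𝔸) (L : ℕ) (q : SiteZ d) (κ : Fin d) (n : SiteZ d) (σ σ' : Equiv.Perm (Fin d)) :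
    asum A q (loopWord L κ n σ σ') =
      asum A q (stairWord σ n) + asum A (q + n) (seg κ (L : ℤ))
        - asum A (q + (L : ℤ) • e κ) (stairWord σ' n) - asum A q (seg κ (L : ℤ)) := by
  have h1 : disp (stairWord σ n) = n := disp_stairWord σ n
  have h2 : disp (stairWord σ' n) = n := disp_stairWord σ' n
  rw [T4Continuum.loopWord, asum_append, h1, asum_append, replicate_true_eq_seg, disp_seg, asum_append,
    wordRev_eq_revWord, disp_revWord, h2, replicate_false_eq_seg_neg]
  have hb : q + n + (L : ℤ) • e κ + -n = q + (L : ℤ) • e κ := by abel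
  rw [hb, asum_revWord' A (x := q + (L : ℤ) • e κ) (q + n + (L : ℤ) • e κ) (stairWord σ' n) (by rw [h2]; abel),
    asum_seg_neg, add_sub_cancel_right]
  abel

end Words

section FirstOrder

variable {𝔸 : Type*} [NormedRing 𝔸] [NormedAlgebra ℂ 𝔸] (L : ℕ)

/-- **The first-order term of the exponent `XZ` of (0.4)**: `mean_i A(loop_i)` over the loop family ([3] p. 25's `Σ_x L^{−d} A(Γ_{c,x} ∪ (−c))` for the record).
[cite: Balaban1985Averaging, p.25 (displays before (47)); Balaban1987RG1, (0.4) p.253] -/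
def XhatZ (A : SiteZ d → Fin d → 𝔸) (q : SiteZ d) (κ : Fin d) : 𝔸 :=
  ∑ i : IdxZ d L, ((Fintype.card (IdxZ d L) : ℝ))⁻¹ • asum A q (loopWord L κ (offZ L i.1) i.2.1 i.2.2)

/-- **The first-order term `TZ_c` of `bavgZ(c) = e^{XZ}·V([q,q′])`**: `XhatZ + A([q, q′])` ([3] (47)–(48)'s `T_c` for the record). [cite: Balaban1985Averaging, (47)–(48) p.25] -/
def TsideZ (A : SiteZ d → Fin d → 𝔸) (q : SiteZ d) (κ : Fin d) : 𝔸 := XhatZ L A q κ + asum A q (seg κ (L : ℤ))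

/-- **The σ-mean staircase functional** `SZ(q)[A] = mean_{(r,σ,σ′)} A(Γ^σ_{q, q + n_r})` — the linear part of the record's would-be SYMMETRISED frame
([I] p. 254's `log U(y,x)` to first order). [cite: Balaban1987RG1, (0.11) p.253, (0.3) p.252] -/
def SZ (A : SiteZ d → Fin d → 𝔸) (q : SiteZ d) : 𝔸 :=
  ∑ i : IdxZ d L, ((Fintype.card (IdxZ d L) : ℝ))⁻¹ • asum A q (stairWord i.2.1 (offZ L i.1))

/-- **THE CURVATURE FUNCTIONAL Φ OF LOCATED-N2**: `PhiZ := SZ − FhatZ` — σ-mean staircase minus tree staircase; by lattice Stokes a signed plaquette sum of the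
curl `dA`; it measures exactly the mismatch between the symmetric loops of (0.4) and the single-staircase frames of the typed record.
[cite: Balaban1987RG1, (0.4) p.253, (0.11) p.253; Balaban1985Averaging, (112) p.34] -/
def PhiZ (A : SiteZ d → Fin d → 𝔸) (q : SiteZ d) : 𝔸 := SZ L A q - FhatZ L A q

/-- The uniform mean over the loop family is a convex combination: `‖mean_i f_i‖ ≤ sup_i ‖f_i‖`. [cite: Balaban1985Averaging, (35) p.23] -/
theorem norm_avgZ_le (hL : 1 ≤ L) (f : IdxZ d L → 𝔸) {K : ℝ} (hf : ∀ i, ‖f i‖ ≤ K) :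
    ‖∑ i : IdxZ d L, ((Fintype.card (IdxZ d L) : ℝ))⁻¹ • f i‖ ≤ K := by
  have hne : Nonempty (IdxZ d L) := ⟨(fun _ => ⟨0, hL⟩, 1, 1)⟩
  have hc : (0 : ℝ) < Fintype.card (IdxZ d L) := by exact_mod_cast Fintype.card_pos
  calc ‖∑ i : IdxZ d L, ((Fintype.card (IdxZ d L) : ℝ))⁻¹ • f i‖
      ≤ ∑ i : IdxZ d L, ‖((Fintype.card (IdxZ d L) : ℝ))⁻¹ • f i‖ := norm_sum_le _ _
    _ ≤ ∑ _i : IdxZ d L, ((Fintype.card (IdxZ d L) : ℝ))⁻¹ * K := Finset.sum_le_sum fun i _ => by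
        rw [norm_smul, Real.norm_of_nonneg (by positivity)]
        exact mul_le_mul_of_nonneg_left (hf i) (by positivity)
    _ = K := by
        rw [Finset.sum_const, Finset.card_univ, nsmul_eq_mul, ← mul_assoc, mul_inv_cancel₀ hc.ne', one_mul]

/-- A summand depending only on the block point: the uniform mean over `(r,σ,σ′)` is the block mean `Σ_r L^{−d}(·)`. [cite: Balaban1987RG1, (0.4) p.253] -/
theorem sum_IdxZ_fst (hL : 1 ≤ L) (g : (Fin d → Fin L) → 𝔸) :
    ∑ i : IdxZ d L, ((Fintype.card (IdxZ d L) : ℝ))⁻¹ • g i.1 = ∑ r : Fin d → Fin L, (((L : ℝ) ^ d)⁻¹) • g r := by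
  have hP : (Fintype.card (Equiv.Perm (Fin d)) : ℝ) ≠ 0 := by exact_mod_cast Fintype.card_pos.ne'
  have hL0 : (L : ℝ) ≠ 0 := by exact_mod_cast (by omega : L ≠ 0)
  have hcard : (Fintype.card (IdxZ d L) : ℝ) = (L : ℝ) ^ d * (Fintype.card (Equiv.Perm (Fin d)) : ℝ) ^ 2 := by
    simp only [IdxZ, Fintype.card_prod, Fintype.card_fun, Fintype.card_fin]
    push_cast
    ring
  rw [Fintype.sum_prod_type]
  refine Finset.sum_congr rfl fun r _ => ?_
  rw [Fintype.sum_prod_type]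
  simp only [Finset.sum_const, Finset.card_univ, smul_smul, ← Nat.cast_smul_eq_nsmul ℝ]
  congr 1
  rw [hcard]
  field_simp

/-- The uniform mean is symmetric in the two orderings `σ ↔ σ′`. [cite: Balaban1987RG1, (0.4) p.253] -/
theorem sum_IdxZ_perm₁ (g : (Fin d → Fin L) → Equiv.Perm (Fin d) → 𝔸) :
    ∑ i : IdxZ d L, ((Fintype.card (IdxZ d L) : ℝ))⁻¹ • g i.1 i.2.1 =
      ∑ i : IdxZ d L, ((Fintype.card (IdxZ d L) : ℝ))⁻¹ • g i.1 i.2.2 := by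
  -- swap the two permutation factors
  let e : IdxZ d L ≃ IdxZ d L :=
    { toFun := fun i => (i.1, i.2.2, i.2.1), invFun := fun i => (i.1, i.2.2, i.2.1),
      left_inv := fun i => rfl, right_inv := fun i => rfl }
  exact (Fintype.sum_equiv e _ _ fun i => rfl)

end FirstOrder

/-! ## §2 The frame cancellation with the curvature functional Φ (LOCATED-N2) -/

section Cancellation

variable {𝔸 : Type*} [NormedRing 𝔸] [NormedAlgebra ℂ 𝔸] (L : ℕ)

/-- ★ **THE FRAME CANCELLATION OF THE TYPED RECORD** (the mechanism of [3] (125) at `V₀ = 1` for symmetric loops + single-staircase frames):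
`−F̂Z(c₋) + TZ_c + F̂Z(c₊) = L·(Q₀A)_c + Φ(c₋) − Φ(c₊)`, `c₋ = q`, `c₊ = q + Le_κ` — an identity of formal sums, no smallness.  With Φ ≡ 0 it is the
engine's `B7Prop3Flat.frame_cancellation`. [cite: Balaban1985Averaging, (120) p.35, (124)–(125) p.36, (14) p.19; Balaban1987RG1, (0.4) p.253] -/
theorem sum_IdxZ_const (hL : 1 ≤ L) (C : 𝔸) : ∑ _i : IdxZ d L, ((Fintype.card (IdxZ d L) : ℝ))⁻¹ • C = C := by
  have hne : Nonempty (IdxZ d L) := ⟨(fun _ => ⟨0, hL⟩, 1, 1)⟩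
  have hc : (Fintype.card (IdxZ d L) : ℝ) ≠ 0 := by exact_mod_cast Fintype.card_pos.ne'
  rw [Finset.sum_const, Finset.card_univ, ← Nat.cast_smul_eq_nsmul ℝ, smul_smul, mul_inv_cancel₀ hc, one_smul]

/-- The first-order term of the exponent, resolved: `XhatZ = SZ(q) + L·(Q₀A)_c − SZ(q′) − A([q,q′])`. [cite: Balaban1987RG1, (0.4) p.253; Balaban1985Averaging, (125) p.36] -/
theorem XhatZ_eq (hL : 1 ≤ L) (A : SiteZ d → Fin d → 𝔸) (q : SiteZ d) (κ : Fin d) :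
    XhatZ L A q κ = SZ L A q + linQZ L A q κ - SZ L A (q + (L : ℤ) • e κ) - asum A q (seg κ (L : ℤ)) := by
  unfold XhatZ
  simp_rw [asum_loopWord, smul_sub, smul_add, Finset.sum_sub_distrib, Finset.sum_add_distrib]
  rw [sum_IdxZ_fst L hL (fun r => asum A (q + offZ L r) (seg κ (L : ℤ))),
    ← sum_IdxZ_perm₁ L (fun r σ => asum A (q + (L : ℤ) • e κ) (stairWord σ (offZ L r))), sum_IdxZ_const L hL]
  rfl

/-- ★ **THE FRAME CANCELLATION OF THE TYPED RECORD** (the mechanism of [3] (125) at `V₀ = 1` for symmetric loops + single-staircase frames):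
`−F̂Z(c₋) + TZ_c + F̂Z(c₊) = L·(Q₀A)_c + Φ(c₋) − Φ(c₊)`, `c₋ = q`, `c₊ = q + Le_κ` — an identity of formal sums, no smallness.  With Φ ≡ 0 it is the
engine's `B7Prop3Flat.frame_cancellation`. [cite: Balaban1985Averaging, (120) p.35, (124)–(125) p.36, (14) p.19; Balaban1987RG1, (0.4) p.253] -/
theorem frame_cancellationZ (hL : 1 ≤ L) (A : SiteZ d → Fin d → 𝔸) (q : SiteZ d) (κ : Fin d) :
    -FhatZ L A q + TsideZ L A q κ + FhatZ L A (q + (L : ℤ) • e κ) =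
      linQZ L A q κ + PhiZ L A q - PhiZ L A (q + (L : ℤ) • e κ) := by
  unfold TsideZ PhiZ
  rw [XhatZ_eq L hL]
  abel

end Cancellation

/-! ## §3 The side estimate (47)–(50) for `bavgZ`, the flat linear bound (126) and the frame estimate (111)–(112), re-run for the record objects -/

section Estimates

variable {𝔸 : Type*} [NormedRing 𝔸] [NormedAlgebra ℂ 𝔸] [CompleteSpace 𝔸]

/-- (RECORD TWIN of `B7Prop1Explicit.side_estimate` for the (0.4) average `bavgZ`: the loop family `WZ … i`, `i : IdxZ d L`, replaces `Wcx … (boxVec r)`; the first-order term is `TsideZ = XhatZ + A([q, q+Le_κ])`, bounded by `2θ`, whence `3θ` in place of `2θ` for `‖Ū − 1‖`; otherwise token-identical.) **p. 25, the displays before (47), for one side** `c = ⟨q, q + Le_κ⟩` of `∂p′`, in the gauge where `V₀ = exp A`, `|A_b| ≤ a`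
on all bonds within `l¹`-distance `R` of `y`: with `θ ≥ (2dL + 2L)·a` (≥ the length of any contour
`Γ_{c,x} ∪ (−Γ_c)` times `a`) and `θ ≤ 1/64`,
`|V̄₀_c − 1| ≤ 2θ`, `|V̄₀_c − 1 − T_c| ≤ 50θ²`, the same for `V̄₀_c⁻¹` with `−T_c`, and `|V₀(Γ_{c,x})V₀(c)⁻¹ − 1| ≤ 2θ`
(inside the analyticity domain of `log`).  The printed `O(1)(L²α₀)²` of
"`|V̄₀,c − 1 − i Σ_{x∈B(c₋)} L^{−d} A(Γ_{c,x})| < O(1)(L²α₀)²`" is `50θ²` here. [cite: Balaban1985Averaging, p.25 (displays before (47))] -/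
theorem side_estimateZ (V₀ : SiteZ d → Fin d → 𝔸ˣ) (A : SiteZ d → Fin d → 𝔸) (y : SiteZ d) (R : ℕ) {a θ : ℝ}
    (ha : 0 ≤ a) (hVA : ∀ x κ, l1 (x - y) ≤ R → ((V₀ x κ : 𝔸ˣ) : 𝔸) = exp (A x κ) ∧ ‖A x κ‖ ≤ a)
    (L : ℕ) (hL : 1 ≤ L) (q : SiteZ d) (κ : Fin d) (hR : l1 (q - y) + (2 * (d * L) + L + L) ≤ R)
    (hθ : ((2 * (d * L) + L + L : ℕ) : ℝ) * a ≤ θ) (hθ0 : 0 ≤ θ) (hθ1 : θ ≤ 1 / 64) :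
    ‖((bavgZ L V₀ q κ : 𝔸ˣ) : 𝔸) - 1‖ ≤ 3 * θ ∧
    ‖((bavgZ L V₀ q κ : 𝔸ˣ) : 𝔸) - 1 - TsideZ L A q κ‖ ≤ 50 * θ ^ 2 ∧
    ‖(((bavgZ L V₀ q κ)⁻¹ : 𝔸ˣ) : 𝔸) - 1‖ ≤ 3 * θ ∧
    ‖(((bavgZ L V₀ q κ)⁻¹ : 𝔸ˣ) : 𝔸) - 1 - (-TsideZ L A q κ)‖ ≤ 50 * θ ^ 2 ∧
    ∀ i : IdxZ d L, ‖((WZ L V₀ q κ i : 𝔸ˣ) : 𝔸) - 1‖ ≤ 2 * θ := by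
  have hA : ∀ x κ, l1 (x - y) ≤ R → ‖A x κ‖ ≤ a := fun x κ hx => (hVA x κ hx).2
  have hNa : ∀ n : ℕ, n ≤ 2 * (d * L) + L + L → (n : ℝ) * a ≤ θ := fun n hn =>
    (mul_le_mul_of_nonneg_right (by exact_mod_cast hn) ha).trans hθ
  -- (47) for the contours `Γ_{c,x} ∪ (−Γ_c)` and the logarithm (26)–(27)
  have hloop : ∀ i : IdxZ d L,
      ‖((WZ L V₀ q κ i : 𝔸ˣ) : 𝔸) - 1‖ ≤ 2 * θ ∧
      ‖MatrixLog.mlog ((WZ L V₀ q κ i : 𝔸ˣ) : 𝔸)‖ ≤ 4 * θ ∧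
      ‖MatrixLog.mlog ((WZ L V₀ q κ i : 𝔸ˣ) : 𝔸)
          - asum A q (loopWord L κ (offZ L i.1) i.2.1 i.2.2)‖ ≤ 17 * θ ^ 2 := by
    intro i
    have hlen : (loopWord L κ (offZ L i.1) i.2.1 i.2.2).length ≤ 2 * (d * L) + L + L := by
      rw [length_loopWord]
      have := l1_offZ_le_dL L i.1
      nlinarith
    obtain ⟨h1, h2⟩ := walk_linear V₀ A y R ha hVA (loopWord L κ (offZ L i.1) i.2.1 i.2.2) q (by omega)
    rw [← WZ_def] at h1 h2
    have hna := hNa _ hlen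
    have hW : ‖((WZ L V₀ q κ i : 𝔸ˣ) : 𝔸) - 1‖ ≤ 2 * θ :=
      h1.trans (exp_sub_one_le_of_le hna hθ0 hθ1)
    have hW' : ‖((WZ L V₀ q κ i : 𝔸ˣ) : 𝔸) - 1‖ ≤ 1 / 2 := hW.trans (by linarith)
    refine ⟨hW, (MatrixLog.norm_mlog_le_two_mul hW').trans (by linarith), ?_⟩
    have h3 := norm_mlog_sub_le hW'
    have h4 : expRem (2 * ‖((WZ L V₀ q κ i : 𝔸ˣ) : 𝔸) - 1‖) ≤ 16 * θ ^ 2 :=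
      (expRem_mono (by positivity) (by linarith)).trans (expRem4_le hθ0 hθ1)
    have h5 := expRem_le_sq_of_le (by positivity) hna hθ0 hθ1
    calc _ = ‖(MatrixLog.mlog ((WZ L V₀ q κ i : 𝔸ˣ) : 𝔸)
              - (((WZ L V₀ q κ i : 𝔸ˣ) : 𝔸) - 1))
            + ((((WZ L V₀ q κ i : 𝔸ˣ) : 𝔸) - 1)
              - asum A q (loopWord L κ (offZ L i.1) i.2.1 i.2.2))‖ := by rw [sub_add_sub_cancel]
      _ ≤ _ := norm_add_le _ _
      _ ≤ 16 * θ ^ 2 + θ ^ 2 := add_le_add (h3.trans h4) (h2.trans h5)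
      _ = 17 * θ ^ 2 := by ring
  -- the exponent `X_c` (42) and its first-order term
  have hXn : ‖XZ L V₀ q κ‖ ≤ 4 * θ := norm_avgZ_le L hL _ fun i => (hloop i).2.1
  have hXXh : ‖XZ L V₀ q κ - XhatZ L A q κ‖ ≤ 17 * θ ^ 2 := by
    rw [XZ, XhatZ, ← Finset.sum_sub_distrib]
    simp_rw [← smul_sub]
    exact norm_avgZ_le L hL _ fun i => (hloop i).2.2
  have hXXh' : ‖-XZ L V₀ q κ - -XhatZ L A q κ‖ ≤ 17 * θ ^ 2 := by
    rwa [← neg_sub', norm_neg]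
  obtain ⟨hE1, hE2⟩ := norm_exp_sub_one_le_of_norm_le hXn
  obtain ⟨hE1', hE2'⟩ := norm_exp_sub_one_le_of_norm_le (show ‖-XZ L V₀ q κ‖ ≤ 4 * θ by rwa [norm_neg])
  have hE8 : ‖exp (XZ L V₀ q κ) - 1‖ ≤ 8 * θ := hE1.trans (exp4_sub_one_le hθ0 hθ1)
  have hE8' : ‖exp (-XZ L V₀ q κ) - 1‖ ≤ 8 * θ := hE1'.trans (exp4_sub_one_le hθ0 hθ1)
  have hE33 : ‖exp (XZ L V₀ q κ) - 1 - XhatZ L A q κ‖ ≤ 33 * θ ^ 2 := by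
    calc _ = ‖(exp (XZ L V₀ q κ) - 1 - XZ L V₀ q κ) + (XZ L V₀ q κ - XhatZ L A q κ)‖ := by
            rw [sub_add_sub_cancel]
      _ ≤ _ := norm_add_le _ _
      _ ≤ 16 * θ ^ 2 + 17 * θ ^ 2 := add_le_add (hE2.trans (expRem4_le hθ0 hθ1)) hXXh
      _ = 33 * θ ^ 2 := by ring
  have hE33' : ‖exp (-XZ L V₀ q κ) - 1 - -XhatZ L A q κ‖ ≤ 33 * θ ^ 2 := by
    calc _ = ‖(exp (-XZ L V₀ q κ) - 1 - -XZ L V₀ q κ) + (-XZ L V₀ q κ - -XhatZ L A q κ)‖ := by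
            rw [sub_add_sub_cancel]
      _ ≤ _ := norm_add_le _ _
      _ ≤ 16 * θ ^ 2 + 17 * θ ^ 2 := add_le_add (hE2'.trans (expRem4_le hθ0 hθ1)) hXXh'
      _ = 33 * θ ^ 2 := by ring
  -- `V₀(c)` and `V₀(c)⁻¹` (47)
  have hfitY : l1 (q - y) + (seg κ (L : ℤ)).length ≤ R := by
    rw [length_seg, Int.natAbs_natCast]; omega
  obtain ⟨hY1, hY2⟩ := walk_linear V₀ A y R ha hVA (seg κ L) q hfitY
  have hLa : (((seg κ (L : ℤ)).length : ℕ) : ℝ) * a ≤ θ := hNa _ (by rw [length_seg, Int.natAbs_natCast]; omega)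
  have hY1' : ‖((hol V₀ q (seg κ L) : 𝔸ˣ) : 𝔸) - 1‖ ≤ 2 * θ := hY1.trans (exp_sub_one_le_of_le hLa hθ0 hθ1)
  have hY2' : ‖((hol V₀ q (seg κ L) : 𝔸ˣ) : 𝔸) - 1 - asum A q (seg κ L)‖ ≤ θ ^ 2 :=
    hY2.trans (expRem_le_sq_of_le (by positivity) hLa hθ0 hθ1)
  have hYinv : (hol V₀ q (seg κ (L : ℤ)))⁻¹ = hol V₀ (q + (L : ℤ) • e κ) (seg κ (-(L : ℤ))) := by
    rw [← revWord_seg, hol_revWord' V₀ (x := q) _ _ (by rw [disp_seg])]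
  have hfitZ : l1 (q + (L : ℤ) • e κ - y) + (seg κ (-(L : ℤ))).length ≤ R := by
    rw [length_seg, Int.natAbs_neg, Int.natAbs_natCast]
    have := l1_add_le (q - y) ((L : ℤ) • e κ)
    rw [l1_zsmul_e, Int.natAbs_natCast, show q - y + (L : ℤ) • e κ = q + (L : ℤ) • e κ - y by abel] at this
    omega
  obtain ⟨hZ1, hZ2⟩ := walk_linear V₀ A y R ha hVA (seg κ (-(L : ℤ))) (q + (L : ℤ) • e κ) hfitZ
  have hLa' : (((seg κ (-(L : ℤ))).length : ℕ) : ℝ) * a ≤ θ :=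
    hNa _ (by rw [length_seg, Int.natAbs_neg, Int.natAbs_natCast]; omega)
  rw [← hYinv] at hZ1 hZ2
  rw [asum_seg_neg, add_sub_cancel_right] at hZ2
  have hZ1' : ‖(((hol V₀ q (seg κ L))⁻¹ : 𝔸ˣ) : 𝔸) - 1‖ ≤ 2 * θ := hZ1.trans (exp_sub_one_le_of_le hLa' hθ0 hθ1)
  have hZ2' : ‖(((hol V₀ q (seg κ L))⁻¹ : 𝔸ˣ) : 𝔸) - 1 - -asum A q (seg κ L)‖ ≤ θ ^ 2 :=
    hZ2.trans (expRem_le_sq_of_le (by positivity) hLa' hθ0 hθ1)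
  -- `|T_c| ≤ 2θ` (the loop part and the segment part, each `≤ θ`)
  have hXh : ‖XhatZ L A q κ‖ ≤ θ := by
    refine norm_avgZ_le L hL _ fun i => ?_
    have hlen : (loopWord L κ (offZ L i.1) i.2.1 i.2.2).length ≤ 2 * (d * L) + L + L := by
      rw [length_loopWord]; have := l1_offZ_le_dL L i.1; nlinarith
    exact (norm_asum_le A y R ha hA _ q (by omega)).trans (hNa _ hlen)
  have hSn : ‖asum A q (seg κ (L : ℤ))‖ ≤ θ := by
    have hlen : (seg κ (L : ℤ)).length ≤ 2 * (d * L) + L + L := by rw [length_seg, Int.natAbs_natCast]; omega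
    exact (norm_asum_le A y R ha hA _ q (by omega)).trans (hNa _ hlen)
  have hTn : ‖TsideZ L A q κ‖ ≤ 2 * θ := by
    unfold TsideZ
    exact (norm_add_le _ _).trans (by linarith)
  -- the products `V̄₀_c = e^{X_c} V₀(c)` and `V̄₀_c⁻¹ = V₀(c)⁻¹ e^{−X_c}`
  have hF : ((bavgZ L V₀ q κ : 𝔸ˣ) : 𝔸) = exp (XZ L V₀ q κ) * ((hol V₀ q (seg κ L) : 𝔸ˣ) : 𝔸) := rfl
  have hFi : (((bavgZ L V₀ q κ)⁻¹ : 𝔸ˣ) : 𝔸) = (((hol V₀ q (seg κ L))⁻¹ : 𝔸ˣ) : 𝔸) * exp (-XZ L V₀ q κ) := by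
    simp only [bavgZ, mul_inv_rev, Units.val_mul, val_inv_expUnit, val_expUnit]
  have hTeq : TsideZ L A q κ = XhatZ L A q κ + asum A q (seg κ L) := rfl
  have hF2 : ‖((bavgZ L V₀ q κ : 𝔸ˣ) : 𝔸) - 1 - TsideZ L A q κ‖ ≤ 50 * θ ^ 2 := by
    rw [hF, hTeq]
    refine (norm_mul_sub_one_sub_le _ _ _ _).trans ?_
    calc _ ≤ 8 * θ * (2 * θ) + 33 * θ ^ 2 + θ ^ 2 := by gcongr
      _ = 50 * θ ^ 2 := by ring
  have hFi2 : ‖(((bavgZ L V₀ q κ)⁻¹ : 𝔸ˣ) : 𝔸) - 1 - -TsideZ L A q κ‖ ≤ 50 * θ ^ 2 := by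
    rw [hFi, hTeq, neg_add, add_comm]
    refine (norm_mul_sub_one_sub_le _ _ _ _).trans ?_
    calc _ ≤ 2 * θ * (8 * θ) + θ ^ 2 + 33 * θ ^ 2 := by gcongr
      _ = 50 * θ ^ 2 := by ring
  have hfirst : ∀ (F T : 𝔸), ‖F - 1 - T‖ ≤ 50 * θ ^ 2 → ‖T‖ ≤ 2 * θ → ‖F - 1‖ ≤ 3 * θ := by
    intro F T h1 h2
    calc ‖F - 1‖ = ‖(F - 1 - T) + T‖ := by rw [sub_add_cancel]
      _ ≤ 50 * θ ^ 2 + 2 * θ := (norm_add_le _ _).trans (add_le_add h1 h2)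
      _ ≤ 3 * θ := by nlinarith
  exact ⟨hfirst _ _ hF2 hTn, hF2, hfirst _ _ hFi2 (by rwa [norm_neg]), hFi2, fun i => (hloop i).1⟩

omit [CompleteSpace 𝔸] in
/-- (RECORD TWIN of `B7Prop3Flat.norm_linQ_le`: centred block points.) **(125)–(126) at `V₀ = 1`, un-normalised**: `|L·(Q₀A)_c| ≤ L·a` if `|A_b| ≤ a` on the bonds of the straight segments
`[x, x′]`, `x ∈ B(c₋)` (all within `l¹`-distance `|c₋ − y|₁ + dL + L` of `y`): the weights `L^{−d}` are a probability
vector and each segment has `L` bonds. [cite: Balaban1985Averaging, (125)–(126) p.36] -/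
theorem norm_linQZ_le (A : SiteZ d → Fin d → 𝔸) (y : SiteZ d) (R : ℕ) {a : ℝ} (ha : 0 ≤ a)
    (hA : ∀ x κ, l1 (x - y) ≤ R → ‖A x κ‖ ≤ a) (L : ℕ) (hL : 1 ≤ L) (q : SiteZ d) (κ : Fin d)
    (hR : l1 (q - y) + (d * L + L) ≤ R) :
    ‖linQZ L A q κ‖ ≤ L * a := by
  refine norm_avg_le L hL _ fun r => ?_
  have hfit : l1 (q + offZ L r - y) + (seg κ (L : ℤ)).length ≤ R := by
    rw [length_seg, Int.natAbs_natCast]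
    have h1 := l1_add_le (q - y) (offZ L r)
    have h2 := l1_offZ_le_dL L r
    rw [show q - y + offZ L r = q + offZ L r - y by abel] at h1
    omega
  have h := norm_asum_le A y R ha hA (seg κ (L : ℤ)) (q + offZ L r) hfit
  rwa [length_seg, Int.natAbs_natCast] at h

end Estimates

end Literature.MathematicalPhysics.QuantumFieldTheory.Balaban1983to89.B7Prop3FlatRecSide
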